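import Summits.SmoothPoincare4.SmoothPoincare4.Theorems.EntropyRungMargerinRailsDefs
import Summits.SmoothPoincare4.SmoothPoincare4.Theorems.EntropyRungChangGurskyYangStubInitialFit
import Literature.Geometry.Riemannian.RicciFlowMaximal
import Literature.Geometry.Riemannian.RicciFlowMaximalProofs
import Literature.Geometry.Riemannian.RicciFlowSingularTimeHolds
import HarnessLib

/-!
# The maximal Ricci flow from a pinched metric is finite-time
(stub `stub_maximalFlow` of line `margerin-cone-hamilton-rails`, crux
`EntropyRung.ChangGurskyYang`, item stmt-SmoothPoincare4-10834)

STUB 4a of the line (first step of the blow-up / round-limit endgame for STUB 4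
`stub_pinchedFlowConvergence`): on a closed connected smooth 4-manifold, if EVERY Ricci flow of
Riemannian metrics `g` on `[0, T)` from `g₀` has the Hamilton blocks `(A, B, C)` of every
orthonormal frame in the pinching set `pinchingSet m c K τ` (`m > 0`; vocabulary of
`Theorems/EntropyRungMargerinRailsDefs.lean`), then there is a MAXIMAL Ricci flow
(`IsMaximalRicciFlow`, finite `T`) starting at `g₀`.

Proof (Hamilton 1982, Thm. 14.1; Topping 2006, Cor. 3.2.4): Hamilton's maximal existence theorem,
a THEOREM of the tree (`ricciFlow_maximal_existence_holds`), gives either an immortal flow on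
`[0, ∞)` or a maximal flow on some `[0, T)`; in the second case we are done. The immortal
alternative is excluded: restricted to `[0, T₁)`, `T₁ := 4/(2m) + 1` (`IsRicciFlow.mono`), the flow
satisfies the pinching hypothesis, whose `{R ≥ m}` face at `t = 0`, read in a `g 0`-orthonormal
basis at each point (`exists_basis_isOrthonormalFrame`) through the dictionary
`tr A + tr C = R` (`trace_blockA_add_trace_blockC`, valid for the flow's own Levi-Civita witness
`cov 0`), gives `R(·, 0) ≥ m > 0`; Topping's Cor. 3.2.4, a THEOREM of the tree
(`ricciFlow_singularTime_le_holds`, `n = finrank ℝ (EuclideanSpace ℝ (Fin 4)) = 4`), then forces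
`T₁ ≤ 4/(2m)`, a contradiction. `[ConnectedSpace M]` supplies `Nonempty M`.
Everything is proved; no definition, no named fact.

References: R. S. Hamilton, J. Differential Geom. 17 (1982) 255–306, §14, Thm. 14.1 (p. 296)
[Hamilton1982]; P. Topping, Lectures on the Ricci flow, LMS LNS 325 (2006), §5.2, p. 46 and
Cor. 3.2.4 (p. 36) [Topping2006]; R. S. Hamilton, J. Differential Geom. 24 (1986) 153–179, §5,
5.2 (p. 164) [Hamilton1986].
-/

noncomputable section

-- the registered namespace `Summit.SmoothPoincare4.SmoothPoincare4.Theorems` repeats a component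
set_option linter.dupNamespace false

open Set Function Module Filter
open scoped Manifold ContDiff Matrix BigOperators Topology

namespace Summit.SmoothPoincare4.SmoothPoincare4.Theorems.MargerinRails

open Literature.Geometry.Riemannian Literature.Geometry.Riemannian.HamiltonODE
open Literature.Geometry.Lorentzian Literature.Geometry.Lorentzian.PseudoRiemannianMetric

/-- **STUB 4a — THE MAXIMAL FLOW FROM `g₀` IS FINITE-TIME** (Hamilton 1982, Thm. 14.1 = tree theorem
`ricciFlow_maximal_existence_holds`: immortal flow or maximal flow on `[0, T)`; the immortal alternative is
excluded because the pinching hypothesis, applied to that flow restricted to `[0, 4/(2m) + 1)`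
(`IsRicciFlow.mono`) at `t = 0`, gives `R = tr A + tr C ≥ m > 0` in an orthonormal basis at every point
(`exists_basis_isOrthonormalFrame`, `trace_blockA_add_trace_blockC`), whence `4/(2m) + 1 ≤ 4/(2m)` by
Topping's Cor. 3.2.4 (`ricciFlow_singularTime_le_holds`). Only the `{R ≥ m}` face of `pinchingSet` is used.
[cite: Hamilton1982, §14, Thm. 14.1 (p. 296)] [cite: Topping2006, Cor. 3.2.4 (p. 36)]
[cite: Hamilton1986, §5, 5.2 (p. 164)] -/
theorem stub_maximalFlow :
    ∀ (M : Type) [TopologicalSpace M] [T2Space M] [SecondCountableTopology M]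
      [ChartedSpace (EuclideanSpace ℝ (Fin 4)) M] [IsManifold (𝓡 4) ∞ M] [CompactSpace M]
      [ConnectedSpace M]
      (g₀ : PseudoRiemannianMetric (𝓡 4) ∞ (EuclideanSpace ℝ (Fin 4)) (TangentSpace (𝓡 4) : M → Type _))
      (m c K τ : ℝ), g₀.IsRiemannian → 0 < m →
      (∀ (T : ℝ)
        (g : ℝ → PseudoRiemannianMetric (𝓡 4) ∞ (EuclideanSpace ℝ (Fin 4))
          (TangentSpace (𝓡 4) : M → Type _))
        (cov : ℝ → CovariantDerivative (𝓡 4) (EuclideanSpace ℝ (Fin 4))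
          (TangentSpace (𝓡 4) : M → Type _)),
        IsRicciFlow g cov (Ico 0 T) → (∀ t ∈ Ico 0 T, (g t).IsRiemannian) → g 0 = g₀ →
        ∀ t ∈ Ico 0 T, ∀ (x : M) (e : Fin 4 → TangentSpace (𝓡 4) x),
          (g t).IsOrthonormalFrame x e →
            ((g t).blockA (cov t) x e, (g t).blockB (cov t) x e, (g t).blockC (cov t) x e) ∈
              pinchingSet m c K τ) →
      ∃ (T : ℝ) (g : ℝ → PseudoRiemannianMetric (𝓡 4) ∞ (EuclideanSpace ℝ (Fin 4))
          (TangentSpace (𝓡 4) : M → Type _))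
        (cov : ℝ → CovariantDerivative (𝓡 4) (EuclideanSpace ℝ (Fin 4))
          (TangentSpace (𝓡 4) : M → Type _)),
        IsMaximalRicciFlow g cov T ∧ g 0 = g₀ := by
  intro M _ _ _ _ _ _ _ g₀ m c K τ hg₀ hm hpinch
  rcases ricciFlow_maximal_existence_holds (𝓡 4) M g₀ hg₀ with
    ⟨g, cov, hflow, hR, h0⟩ | ⟨T, -, g, cov, hmax, h0⟩
  · -- an immortal flow from pinched data is impossible: `T₁ ≤ 4/(2m)` for `T₁ = 4/(2m) + 1`
    exfalso
    set T₁ : ℝ := 4 / (2 * m) + 1 with hT₁def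
    have hT₁ : 0 < T₁ := by positivity
    have hflow₁ : IsRicciFlow g cov (Ico 0 T₁) := hflow.mono Ico_subset_Ici_self
    have hR₁ : ∀ t ∈ Ico 0 T₁, (g t).IsRiemannian := fun t ht ↦ hR t ht.1
    have h0mem : (0 : ℝ) ∈ Ico 0 T₁ := ⟨le_rfl, hT₁⟩
    have hLC : (g 0).IsLeviCivita (cov 0) := hflow₁.isLeviCivita 0 h0mem
    have hn : (2 : ℕ∞ω) ≤ ∞ := WithTop.coe_le_coe.mpr le_top
    have hE : finrank ℝ (EuclideanSpace ℝ (Fin 4)) = 4 := finrank_euclideanSpace_fin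
    -- the `{R ≥ m}` face of the pinching set at `t = 0`, read through `tr A + tr C = R`
    have hscal : ∀ x : M, m ≤ (g 0).scalarCurvatureWith (cov 0) x := by
      intro x
      obtain ⟨b, hb⟩ := (g 0).exists_basis_isOrthonormalFrame (x := x)
        (fun v hv ↦ hR₁ 0 h0mem x v hv) hE
      have hmem := hpinch T₁ g cov hflow₁ hR₁ h0 0 h0mem x b hb
      have hface : m ≤ ((g 0).blockA (cov 0) x b).trace + ((g 0).blockC (cov 0) x b).trace :=
        (mem_pinchingSet.1 hmem).2.1
      rwa [trace_blockA_add_trace_blockC x hLC hn b hb] at hface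
    have hle := ricciFlow_singularTime_le_holds (𝓡 4) M T₁ hT₁ g cov hflow₁ hR₁ m hm hscal
    have hrank : (finrank ℝ (EuclideanSpace ℝ (Fin 4)) : ℝ) = 4 := by rw [hE]; norm_num
    rw [hrank] at hle
    have : (4 / (2 * m) + 1 : ℝ) ≤ 4 / (2 * m) := hle
    linarith
  · exact ⟨T, g, cov, hmax, h0⟩

end Summit.SmoothPoincare4.SmoothPoincare4.Theorems.MargerinRails

end
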